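import Summits.BirchSwinnertonDyer.BirchSwinnertonDyer.Theorems.CongruentShaFreeCutTwoAdicLinks
import Summits.BirchSwinnertonDyer.BirchSwinnertonDyer.Theorems.CongruentShaFreeCutTwoAdicSelmerFinite
import Summits.BirchSwinnertonDyer.Rank1Residual.GaloisImage.PropagatedConditionCardEP
import Summits.BirchSwinnertonDyer.Rank1Residual.X11b.RouteR1LogOmega

/-! # Route `CongruentShaFreeCut` (rung S2) — crux `AnalyticRankOneOfRankOneFiniteShaTwo`
(stmt-BirchSwinnertonDyer-19080): the STRUCTURE of Link B — what the registered stub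
`stub_twoAdicCharValueEqHeegnerLogSq` says once the free constant is eliminated, and its
EQUIVALENCE with crux B on the crux's own data

Cell `bsd-cn100`, prover seat `bsd-cn100-s2-c3` g4. Supports, does not close,
stmt-BirchSwinnertonDyer-19080. HONEST FRAMING: theorems ABOUT the two open links of the registered
skeleton `two-adic-links` (`CongruentShaFreeCutTwoAdicLinks`, p424074); every statement involving
crux B or a link is CONDITIONAL on the hypotheses it names (Link A / Poitou–Tate, Kato, modularity,
Gross–Zagier + Kolyvagin, crux B itself); nothing about BSD, the leaf
`rankOne_twoConverse_congruentNumber` or the congruent number problem is proved, and no link is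
proved. The purpose is a kernel-checked reading of the split for the planner's census and the
tribunal's conjunct reading (T1 strength: "C ⇒ S" checks).

## What is proved

The Literature predicate behind Link B, `AcPConverseLinks.CharValueEqLogSqAt W p κ 𝔭 γ ι P`
("`𝔛` is `Λ`-torsion and a generator `F` of `char_Λ 𝔛` has `F(0) = u · (log_ω P)²` for SOME
`u ≠ 0`"), carries no constant: since `u` is free,

* `charValueEqLogSqAt_iff` — **`CharValueEqLogSqAt … P` ⟺ `𝔛` is `Λ`-torsion and `char_Λ 𝔛 = (F)`
  with `(F(0) = 0 ↔ P is torsion)`** (GENERIC: any `W/ℚ` elliptic globally minimal, any `p`, any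
  datum; `log_ω P = 0 ↔ P` torsion is the tree theorem `X11b.R1.logOmega_eq_zero_iff`, AEC IV.6.4);
* `charValueEqLogSqAt_iff_not_isOfFinAddOrder` — granted Link A's conclusion at the datum
  (`∃ m, AcSelmer.XAc.HasCharValuationAt … m`, i.e. `F(0) ≠ 0`), **`CharValueEqLogSqAt … P` ⟺ `P` is
  not torsion**; `charValueEqLogSqAt_of_hasCharValuationAt_of_not_isOfFinAddOrder` (the converse of
  the tree's `AcPConverseLinks.not_isOfFinAddOrder_of_links`).

For the congruent number curves at `p = 2`:

* `twoAdicCharValue_onCruxData_of_linkA_of_heegnerNonTorsionAtTwo` — on the data of crux B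
  (square-free `n`; `K` with the Heegner hypotheses for `N(E_n)` and `2`; `L(E_n^{(d_K)}, 1) ≠ 0`;
  `rank E_n(ℚ) = 1`; `#Ш(E_n/ℚ)[2^∞] < ∞`; any `(ι, v, v̄, κ, γ)`; any Heegner point `P`), Link A +
  the ℚ-level cut `HeegnerNonTorsionAtTwo` (g0, p418170) + Kato give the conclusion of Link B;
* **`twoAdicCharValue_onCruxData_of_cruxB`** — hence, granted Poitou–Tate (Link A modulo that one
  fact: `twoAdicControlOfRankOne_of_poitouTate_of_localEulerChar`, p429679, with the local Euler
  characteristic a tree theorem `EP.forall_localEulerPoincareCharacteristic_adicCompletion`), Kato,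
  modularity and Gross–Zagier + Kolyvagin, **crux B implies Link B on crux B's own data**. With
  `cruxB_of_twoAdicLinks` (p424074: Link A → Link B → crux B) the two are EQUIVALENT there modulo
  these refereed/textbook facts: the split `two-adic-links` isolates NO statement strictly between
  Link A and crux B on the rank-one data. What the registered Link B says BEYOND crux B lives on the
  data «`corank_{ℤ₂} Sel_{2^∞}(E_n/K) = 1`» not known to be rank-one data, where (by
  `charValueEqLogSqAt_iff`) it reads: `𝔛` is `Λ`-torsion and `F(0) = 0 ↔ P_K` is torsion — the
  `2`-adic anticyclotomic main conjecture at the trivial character in the non-vanishing currency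
  (its «`F(0) ≠ 0 ⇒ P_K` non-torsion» half is the `p`-converse content; its «`P_K` non-torsion ⇒
  `F(0) ≠ 0`» half follows from Gross–Zagier–Kolyvagin + Link A).
[cite: CastellaGrossiLeeSkinner2022, §5.2 (proof of Thm. 5.2.1: shape of a BDP-type p-converse)]
[cite: Castella2018, Thm. 2.3 and Thm. 3.2 (arXiv:1704.06608 pp. 5, 9) (shapes)]
[cite: SilvermanAEC2009, IV.6.4 and VII.6.3 (kernel of the formal logarithm)] -/

set_option linter.dupNamespace false

noncomputable section

open scoped Classical

namespace Summit.BirchSwinnertonDyer.BirchSwinnertonDyer.Theorems.CongruentShaFreeCutLinkBStructure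

open WeierstrassCurve NumberField IsDedekindDomain Field Literature.NumberTheory.EllipticCurves
  Literature.NumberTheory.EllipticCurves.Castella2018
open Literature.NumberTheory.GaloisRepresentations Literature.NumberTheory.GaloisCohomology
open Summit.BirchSwinnertonDyer.Rank1Residual
open Summit.BirchSwinnertonDyer.Rank1Residual.X11b.Halves (logOmega)
open Summit.BirchSwinnertonDyer.BirchSwinnertonDyer.Theses.CongruentShaFreeCut
  (AnalyticRankOneOfRankOneFiniteShaTwo)
open Summit.BirchSwinnertonDyer.BirchSwinnertonDyer.Theorems.CongruentShaFreeCutOfHeegnerNonTorsion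
  (HeegnerNonTorsionAtTwo heegnerNonTorsionAtTwo_of_cruxB)
open Summit.BirchSwinnertonDyer.BirchSwinnertonDyer.Theorems.CongruentShaFreeCutTwoAdicLinks
open Summit.BirchSwinnertonDyer.BirchSwinnertonDyer.Theorems.CongruentShaFreeCutTwoAdicSelmerFinite

/-! ## 1. The predicate `CharValueEqLogSqAt` without its free constant (GENERIC) -/

section Generic

variable (W : WeierstrassCurve ℚ) [W.IsElliptic] [W.IsGloballyMinimal] (p : ℕ) [Fact p.Prime]
  {K : Type} [Field K] [NumberField K] (κ : ZpExtension K p) (𝔭 : HeightOneSpectrum (𝓞 K))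
  (γ : absoluteGaloisGroup K) [Fact (κ.IsTopGenerator γ)] (ι : K →+* ℚ_[p])
  (P : (W.baseChange K).toAffine.Point)

/-- **`CharValueEqLogSqAt` with the constant eliminated.** For any elliptic, globally minimal `W/ℚ`,
prime `p`, anticyclotomic datum `(κ, 𝔭, γ)`, embedding `ι : K → ℚ_p` and `P ∈ E(K)`:
`CharValueEqLogSqAt W p κ 𝔭 γ ι P` ("`𝔛` torsion and `F(0) = u · (log_ω P)²` for some `u ≠ 0`")
holds iff `𝔛` is `Λ`-torsion and some generator `F` of `char_Λ 𝔛` has `F(0) = 0 ↔ P` torsion.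
(`→`: `u ≠ 0`, and `log_ω P = 0 ↔ P` torsion, `X11b.R1.logOmega_eq_zero_iff`; `←`: take `u = 1` if
`P` is torsion, `u = F(0)/(log_ω P)²` otherwise.) The printed instances pin `u` (CGLS (5.4):
`u ∈ ℤ_p^× c_E⁻²(1 − a_p p⁻¹ + p⁻¹)²`); the predicate keeps only what a `p`-converse consumes.
[cite: CastellaGrossiLeeSkinner2022, Thm. 5.1.3 and display (5.4) (shape)]
[cite: SilvermanAEC2009, IV.6.4 and VII.6.3] -/
theorem charValueEqLogSqAt_iff :
    AcPConverseLinks.CharValueEqLogSqAt W p κ 𝔭 γ ι P ↔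
      Module.IsTorsion (IwasawaAlgebra p) (AcSelmer.XAc (W.baseChange K) p κ 𝔭 ∅ γ) ∧
        ∃ F : IwasawaAlgebra p, AcSelmer.XAc.charIdeal (W.baseChange K) p κ 𝔭 ∅ γ = Ideal.span {F} ∧
          (PowerSeries.constantCoeff F = 0 ↔ IsOfFinAddOrder P) := by
  have hlog : logOmega W p ι P = 0 ↔ IsOfFinAddOrder P := X11b.R1.logOmega_eq_zero_iff W p ι P
  constructor
  · rintro ⟨htors, F, hF, u, hu, hval⟩
    refine ⟨htors, F, hF, ?_⟩
    change ((PowerSeries.constantCoeff F : ℤ_[p]) : ℚ_[p]) = u * (logOmega W p ι P) ^ 2 at hval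
    rw [← hlog]
    constructor
    · intro h0
      rw [h0, PadicInt.coe_zero] at hval
      rcases mul_eq_zero.mp hval.symm with h | h
      · exact absurd h hu
      · exact (pow_eq_zero_iff two_ne_zero).mp h
    · intro hL
      rwa [hL, zero_pow two_ne_zero, mul_zero, PadicInt.coe_eq_zero] at hval
  · rintro ⟨htors, F, hF, hiff⟩
    refine ⟨htors, F, hF, ?_⟩
    by_cases hP : IsOfFinAddOrder P
    · refine ⟨1, one_ne_zero, ?_⟩
      change ((PowerSeries.constantCoeff F : ℤ_[p]) : ℚ_[p]) = 1 * (logOmega W p ι P) ^ 2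
      rw [hlog.mpr hP, hiff.mpr hP, PadicInt.coe_zero, zero_pow two_ne_zero, mul_zero]
    · have hL : logOmega W p ι P ≠ 0 := fun h ↦ hP (hlog.mp h)
      have hF0 : ((PowerSeries.constantCoeff F : ℤ_[p]) : ℚ_[p]) ≠ 0 := by
        rw [Ne, PadicInt.coe_eq_zero]
        exact fun h ↦ hP (hiff.mp h)
      refine ⟨((PowerSeries.constantCoeff F : ℤ_[p]) : ℚ_[p]) / (logOmega W p ι P) ^ 2,
        div_ne_zero hF0 (pow_ne_zero _ hL), ?_⟩
      change ((PowerSeries.constantCoeff F : ℤ_[p]) : ℚ_[p]) = _ * (logOmega W p ι P) ^ 2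
      rw [div_mul_cancel₀ _ (pow_ne_zero _ hL)]

variable {W p κ 𝔭 γ P} in
/-- **Link B at a datum from Link A's conclusion and non-torsion of the point** (the converse of the
tree's `AcPConverseLinks.not_isOfFinAddOrder_of_links`): if `𝔛` is `Λ`-torsion with a generator
`F_A` of `char_Λ 𝔛` having `F_A(0) ≠ 0` (`∃ m, HasCharValuationAt … m`) and `P` is not torsion, then
`CharValueEqLogSqAt … P` holds, with `u = F_A(0)/(log_ω P)²`. [cite: CastellaGrossiLeeSkinner2022, §5.2 (proof of Thm. 5.2.1) (shape)]
[cite: SilvermanAEC2009, IV.6.4 and VII.6.3] -/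
theorem charValueEqLogSqAt_of_hasCharValuationAt_of_not_isOfFinAddOrder
    (hA : ∃ m : ℕ, AcSelmer.XAc.HasCharValuationAt (W.baseChange K) p κ 𝔭 ∅ γ m)
    (hP : ¬ IsOfFinAddOrder P) : AcPConverseLinks.CharValueEqLogSqAt W p κ 𝔭 γ ι P := by
  obtain ⟨_, htors, F, hF, hF0, -⟩ := hA
  exact (charValueEqLogSqAt_iff W p κ 𝔭 γ ι P).mpr
    ⟨htors, F, hF, ⟨fun h ↦ absurd h hF0, fun h ↦ absurd h hP⟩⟩

variable {W p κ 𝔭 γ P} in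
/-- **Granted Link A's conclusion at the datum, Link B there is EQUIVALENT to "`P` is not torsion".**
(`→` is `AcPConverseLinks.not_isOfFinAddOrder_of_links`: two generators of one principal ideal of
`Λ` differ by a unit; `←` is `charValueEqLogSqAt_of_hasCharValuationAt_of_not_isOfFinAddOrder`.)
[cite: CastellaGrossiLeeSkinner2022, §5.2 (proof of Thm. 5.2.1) (shape)] -/
theorem charValueEqLogSqAt_iff_not_isOfFinAddOrder
    (hA : ∃ m : ℕ, AcSelmer.XAc.HasCharValuationAt (W.baseChange K) p κ 𝔭 ∅ γ m) :
    AcPConverseLinks.CharValueEqLogSqAt W p κ 𝔭 γ ι P ↔ ¬ IsOfFinAddOrder P :=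
  ⟨fun hB ↦ AcPConverseLinks.not_isOfFinAddOrder_of_links W p κ 𝔭 γ ι P hA hB,
    charValueEqLogSqAt_of_hasCharValuationAt_of_not_isOfFinAddOrder ι hA⟩

end Generic

/-! ## 2. Link B of crux B on crux B's own data -/

/-- **On the data of crux B, Link A + `HeegnerNonTorsionAtTwo` (+ Kato) give Link B's conclusion.**
For square-free `n`, `K` imaginary quadratic with the Heegner hypotheses for `N = N(E_n)` and `2`,
`L(E_n^{(d_K)}, 1) ≠ 0`, `rank E_n(ℚ) = 1`, `#Ш(E_n/ℚ)[2^∞] < ∞`, any `(ι, v, v̄, κ, γ)` as in the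
links and any Heegner point `P ∈ E_n(K)` of level `N`: `CharValueEqLogSqAt E_n 2 κ v̄ γ ι P`.
Proof: Kato descends the rank-one data to `K` (`rank_corank_sha_baseChange_of_twist_L_one_ne_zero`),
Link A (`hA`) gives `F(0) ≠ 0`, `HeegnerNonTorsionAtTwo` (`hNT`) gives `P` non-torsion, and
`charValueEqLogSqAt_of_hasCharValuationAt_of_not_isOfFinAddOrder` concludes. CONDITIONAL on `hA`,
`hNT`, `hKato`; credits nothing. [cite: CastellaGrossiLeeSkinner2022, §5.2 (proof of Thm. 5.2.1) (shape)]
[cite: Kato2004Asterisque, Cor. 14.3 (p. 235)] -/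
theorem twoAdicCharValue_onCruxData_of_linkA_of_heegnerNonTorsionAtTwo
    (hKato : ∀ (W : WeierstrassCurve ℚ) [W.IsElliptic] (p : ℕ) [Fact p.Prime],
      kato_finite_of_L_one_ne_zero W p)
    (hA : TwoAdicControlOfRankOne) (hNT : HeegnerNonTorsionAtTwo)
    ⦃n : ℕ⦄ (hn : Squarefree n) [(congruentNumberCurve n).IsElliptic]
    [(congruentNumberCurve n).IsGloballyMinimal]
    (K : Type) [Field K] [NumberField K] (N : ℕ) [NeZero N]
    (hN : (congruentNumberCurve n).conductorNorm ℤ = N) (hK : IsImaginaryQuadratic K)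
    (hHN : SatisfiesHeegnerHypothesis N K) (hH2 : SatisfiesHeegnerHypothesis 2 K)
    (hL : ((congruentNumberCurve n).quadraticTwist (NumberField.discr K : ℚ)).entireLFunction 1 ≠ 0)
    (hrank : (congruentNumberCurve n).mordellWeilRank = 1)
    (hsha : Finite (AddCommGroup.primaryComponent (congruentNumberCurve n).sha 2))
    (ι : K →+* ℚ_[2]) (v vbar : HeightOneSpectrum (𝓞 K))
    (hv : ∀ x : 𝓞 K, x ∈ v.asIdeal ↔ ‖ι (x : K)‖ < 1) (hvbar : ((2 : ℕ) : 𝓞 K) ∈ vbar.asIdeal)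
    (hne : vbar ≠ v) (κ : ZpExtension K 2) (hκ : κ.IsAnticyclotomic)
    (γ : absoluteGaloisGroup K) [Fact (κ.IsTopGenerator γ)]
    (P : ((congruentNumberCurve n).baseChange K).toAffine.Point)
    (hP : IsHeegnerPoint N (congruentNumberCurve n) K P) :
    AcPConverseLinks.CharValueEqLogSqAt (congruentNumberCurve n) 2 κ vbar γ ι P := by
  obtain ⟨hrk, -, hshaK⟩ := AcPConverseLinks.rank_corank_sha_baseChange_of_twist_L_one_ne_zero
    hKato (congruentNumberCurve n) 2 hK hL hrank hsha
  exact charValueEqLogSqAt_of_hasCharValuationAt_of_not_isOfFinAddOrder ι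
    (hA hn K N hN hK hHN hH2 ι v vbar hv hvbar hne κ hκ γ hrk hshaK)
    (hNT hn K N hN hK hHN hH2 hL hrank hsha P hP)

/-- **Crux B implies Link B on crux B's own data** (granted Poitou–Tate, Kato, modularity and
Gross–Zagier + Kolyvagin). With the hypotheses of
`twoAdicCharValue_onCruxData_of_linkA_of_heegnerNonTorsionAtTwo` supplied by: Link A modulo
Poitou–Tate (`twoAdicControlOfRankOne_of_poitouTate_of_localEulerChar`, p429679, its local Euler
characteristic binder being the tree theorem `EP.forall_localEulerPoincareCharacteristic_adicCompletion`)
and `HeegnerNonTorsionAtTwo` from crux B (`heegnerNonTorsionAtTwo_of_cruxB`, p419056: modularity for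
`ord L(E_n/K) = ord L(E_n) + ord L(E_n^{(d_K)})`, Gross–Zagier + Kolyvagin for "`ord = 1 ↔ y_K`
non-torsion"). Together with `cruxB_of_twoAdicLinks` (Link A → Link B → crux B), Link B restricted
to crux B's data and crux B are EQUIVALENT modulo these named facts. CONDITIONAL; credits nothing.
[cite: GrossZagier1986, Thm. I.6.3 with V.§2] [cite: MilneADT2006, Ch. I, Thm. 4.10(b) (hypothesis kept)]
[cite: CastellaGrossiLeeSkinner2022, §5.2 (proof of Thm. 5.2.1) (shape)] -/
theorem twoAdicCharValue_onCruxData_of_cruxB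
    (hmod : ModularForms.exists_isNewformOf)
    (hGZ : ∀ (W : WeierstrassCurve ℚ) (N : ℕ) [NeZero N] (K : Type) [Field K] [NumberField K],
      analyticRankEK_eq_one_iff_heegner_nonTorsion W N K)
    (hKato : ∀ (W : WeierstrassCurve ℚ) [W.IsElliptic] (p : ℕ) [Fact p.Prime],
      kato_finite_of_L_one_ne_zero W p)
    (hPT : ∀ (K : Type) [Field K] [NumberField K], poitouTate_sum_localTatePairing_eq_zero K)
    (hB : AnalyticRankOneOfRankOneFiniteShaTwo)
    ⦃n : ℕ⦄ (hn : Squarefree n) [(congruentNumberCurve n).IsElliptic]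
    [(congruentNumberCurve n).IsGloballyMinimal]
    (K : Type) [Field K] [NumberField K] (N : ℕ) [NeZero N]
    (hN : (congruentNumberCurve n).conductorNorm ℤ = N) (hK : IsImaginaryQuadratic K)
    (hHN : SatisfiesHeegnerHypothesis N K) (hH2 : SatisfiesHeegnerHypothesis 2 K)
    (hL : ((congruentNumberCurve n).quadraticTwist (NumberField.discr K : ℚ)).entireLFunction 1 ≠ 0)
    (hrank : (congruentNumberCurve n).mordellWeilRank = 1)
    (hsha : Finite (AddCommGroup.primaryComponent (congruentNumberCurve n).sha 2))
    (ι : K →+* ℚ_[2]) (v vbar : HeightOneSpectrum (𝓞 K))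
    (hv : ∀ x : 𝓞 K, x ∈ v.asIdeal ↔ ‖ι (x : K)‖ < 1) (hvbar : ((2 : ℕ) : 𝓞 K) ∈ vbar.asIdeal)
    (hne : vbar ≠ v) (κ : ZpExtension K 2) (hκ : κ.IsAnticyclotomic)
    (γ : absoluteGaloisGroup K) [Fact (κ.IsTopGenerator γ)]
    (P : ((congruentNumberCurve n).baseChange K).toAffine.Point)
    (hP : IsHeegnerPoint N (congruentNumberCurve n) K P) :
    AcPConverseLinks.CharValueEqLogSqAt (congruentNumberCurve n) 2 κ vbar γ ι P :=
  twoAdicCharValue_onCruxData_of_linkA_of_heegnerNonTorsionAtTwo hKato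
    (twoAdicControlOfRankOne_of_poitouTate_of_localEulerChar hPT
      fun K _ _ ↦ GaloisImage.EP.forall_localEulerPoincareCharacteristic_adicCompletion K)
    (heegnerNonTorsionAtTwo_of_cruxB hmod hGZ hB)
    hn K N hN hK hHN hH2 hL hrank hsha ι v vbar hv hvbar hne κ hκ γ P hP

/-- **On crux B's data, granted Link A there, Link B's conclusion at a Heegner point is EQUIVALENT to
that point being non-torsion** — the pointwise form of "Link B|crux-B data ⟺ `HeegnerNonTorsionAtTwo`".
CONDITIONAL on `hA` and Kato; credits nothing. [cite: CastellaGrossiLeeSkinner2022, §5.2 (proof of Thm. 5.2.1) (shape)] -/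
theorem twoAdicCharValue_iff_not_isOfFinAddOrder_onCruxData
    (hKato : ∀ (W : WeierstrassCurve ℚ) [W.IsElliptic] (p : ℕ) [Fact p.Prime],
      kato_finite_of_L_one_ne_zero W p)
    (hA : TwoAdicControlOfRankOne)
    ⦃n : ℕ⦄ (hn : Squarefree n) [(congruentNumberCurve n).IsElliptic]
    [(congruentNumberCurve n).IsGloballyMinimal]
    (K : Type) [Field K] [NumberField K] (N : ℕ) [NeZero N]
    (hN : (congruentNumberCurve n).conductorNorm ℤ = N) (hK : IsImaginaryQuadratic K)
    (hHN : SatisfiesHeegnerHypothesis N K) (hH2 : SatisfiesHeegnerHypothesis 2 K)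
    (hL : ((congruentNumberCurve n).quadraticTwist (NumberField.discr K : ℚ)).entireLFunction 1 ≠ 0)
    (hrank : (congruentNumberCurve n).mordellWeilRank = 1)
    (hsha : Finite (AddCommGroup.primaryComponent (congruentNumberCurve n).sha 2))
    (ι : K →+* ℚ_[2]) (v vbar : HeightOneSpectrum (𝓞 K))
    (hv : ∀ x : 𝓞 K, x ∈ v.asIdeal ↔ ‖ι (x : K)‖ < 1) (hvbar : ((2 : ℕ) : 𝓞 K) ∈ vbar.asIdeal)
    (hne : vbar ≠ v) (κ : ZpExtension K 2) (hκ : κ.IsAnticyclotomic)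
    (γ : absoluteGaloisGroup K) [Fact (κ.IsTopGenerator γ)]
    (P : ((congruentNumberCurve n).baseChange K).toAffine.Point) :
    AcPConverseLinks.CharValueEqLogSqAt (congruentNumberCurve n) 2 κ vbar γ ι P ↔
      ¬ IsOfFinAddOrder P := by
  obtain ⟨hrk, -, hshaK⟩ := AcPConverseLinks.rank_corank_sha_baseChange_of_twist_L_one_ne_zero
    hKato (congruentNumberCurve n) 2 hK hL hrank hsha
  exact charValueEqLogSqAt_iff_not_isOfFinAddOrder ι
    (hA hn K N hN hK hHN hH2 ι v vbar hv hvbar hne κ hκ γ hrk hshaK)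

end Summit.BirchSwinnertonDyer.BirchSwinnertonDyer.Theorems.CongruentShaFreeCutLinkBStructure

end
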